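import Summits.Ventures.HSemireg.Pad4TowerLineDesignCert12Closure

/-!
# Pad4Tower ∕ LineDesignCert12 — KERNEL DECIDES (3∕7, `RuleD3`): RULE D (μ₄, M) at the `P`-heads of chunks 13–47 of 47

Tree cut of the KERNEL CERTIFICATE `Cert12`: the `decide +kernel` theorems of this module are, by NAME, STATEMENT and PROOF, those of the farm-certified
Cruxes-level parts `CeilingLineCert12A–E` (split5); the module boundary is set by the gate's build budget only. Each theorem is one static-family check at a few
heads of the design `cfg` of `Pad4TowerLineDesignCert12Closure`; the assembly is in `Pad4TowerLineDesignCert12`.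

MODULE SET (tree cut of ONE certificate; one namespace `Summit.Ventures.HSemireg.Pad4Tower.LineDesignCert12`): `…Cert12DataN` ∕ `DataP` ∕ `DataPd` ∕ `DataNd` (the support and its literal
dual-0 world, DATA ONLY) → `…Cert12Closure` (key-chain `Nodup`, the design `cfg`, the literal dual `cfgd` and `cfg_dual_eq`, ◇₁₂, the ceiling line, per-chunk
G₁ closure ⇒ `cfg` is Δ- and S₄-closed) → `…Cert12RuleD1` ∕ `…Cert12RuleD2` ∕ `…Cert12RuleD3` ∕ `…Cert12XPlus1` ∕ `…Cert12XPlus2` ∕ `…Cert12XPlus3` ∕ `…Cert12XPlus4` (the RULE D (μ₄, M) resp. guarded X⁺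
decides, a few heads per theorem, module boundaries set by the gate's build budget only) → `Pad4TowerLineDesignCert12` (assembly `cfg_staticH1` and the
UNCONDITIONAL doors `¬ SeedB1OddDiamondG1H1 12`, `¬ SeedB1OddConeG1H1`, `¬ SeedB1OddDiamondG1H1 h'` (12 ≤ h'), the LINE shape, every support cell's realisability).

NOTHING IN THIS MODULE SET SAYS THAT HC ∕ HC_CM ∕ HC_AV ∕ H2 ∕ stmt-HodgeConjecture-18881 HOLDS OR FAILS (HC_CM is a displayed binder of the
ladder only); the certified statements concern the typed FIRST-ORDER static game (`RuleDMu4Closed`, `XPlusClosed`, `A2IMinusClosed` = `MConfig.StaticH1`)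
of ONE explicit finite support — first order is necessary, not sufficient, for a seed; no σ, no seed, no census row. `decide +kernel` only: NO `native_decide`,
no `sorry`, no `axiom`, no `instance`, no notation, no Literature fact, no new `def … : Prop`.
-/

set_option linter.dupNamespace false

namespace Summit.Ventures.HSemireg.Pad4Tower.LineDesignCert12

open Summit.Ventures.HSemireg Summit.Ventures.HSemireg.Pad4Tower

set_option maxRecDepth 32768
set_option Elab.async false
set_option synthInstance.maxSize 8192
set_option synthInstance.maxHeartbeats 2000000
set_option maxHeartbeats 8000000

/-! RULE D (μ₄, M) at the `P`-cells, heads chunked (10 per theorem) -/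

/-- RULE D (μ₄, M) holds at the `P`-heads of chunk 13∕47. [kernel `decide`] -/
theorem ruleDP_13 : ∀ P ∈ lP_13, RuleDMu4P cfg P := by decide +kernel
/-- RULE D (μ₄, M) holds at the `P`-heads of chunk 14∕47. [kernel `decide`] -/
theorem ruleDP_14 : ∀ P ∈ lP_14, RuleDMu4P cfg P := by decide +kernel
/-- RULE D (μ₄, M) holds at the `P`-heads of chunk 15∕47. [kernel `decide`] -/
theorem ruleDP_15 : ∀ P ∈ lP_15, RuleDMu4P cfg P := by decide +kernel
/-- RULE D (μ₄, M) holds at the `P`-heads of chunk 16∕47. [kernel `decide`] -/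
theorem ruleDP_16 : ∀ P ∈ lP_16, RuleDMu4P cfg P := by decide +kernel
/-- RULE D (μ₄, M) holds at the `P`-heads of chunk 17∕47. [kernel `decide`] -/
theorem ruleDP_17 : ∀ P ∈ lP_17, RuleDMu4P cfg P := by decide +kernel
/-- RULE D (μ₄, M) holds at the `P`-heads of chunk 18∕47. [kernel `decide`] -/
theorem ruleDP_18 : ∀ P ∈ lP_18, RuleDMu4P cfg P := by decide +kernel
/-- RULE D (μ₄, M) holds at the `P`-heads of chunk 19∕47. [kernel `decide`] -/
theorem ruleDP_19 : ∀ P ∈ lP_19, RuleDMu4P cfg P := by decide +kernel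
/-- RULE D (μ₄, M) holds at the `P`-heads of chunk 20∕47. [kernel `decide`] -/
theorem ruleDP_20 : ∀ P ∈ lP_20, RuleDMu4P cfg P := by decide +kernel
/-- RULE D (μ₄, M) holds at the `P`-heads of chunk 21∕47. [kernel `decide`] -/
theorem ruleDP_21 : ∀ P ∈ lP_21, RuleDMu4P cfg P := by decide +kernel
/-- RULE D (μ₄, M) holds at the `P`-heads of chunk 22∕47. [kernel `decide`] -/
theorem ruleDP_22 : ∀ P ∈ lP_22, RuleDMu4P cfg P := by decide +kernel
/-- RULE D (μ₄, M) holds at the `P`-heads of chunk 23∕47. [kernel `decide`] -/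
theorem ruleDP_23 : ∀ P ∈ lP_23, RuleDMu4P cfg P := by decide +kernel
/-- RULE D (μ₄, M) holds at the `P`-heads of chunk 24∕47. [kernel `decide`] -/
theorem ruleDP_24 : ∀ P ∈ lP_24, RuleDMu4P cfg P := by decide +kernel
/-- RULE D (μ₄, M) holds at the `P`-heads of chunk 25∕47. [kernel `decide`] -/
theorem ruleDP_25 : ∀ P ∈ lP_25, RuleDMu4P cfg P := by decide +kernel
/-- RULE D (μ₄, M) holds at the `P`-heads of chunk 26∕47. [kernel `decide`] -/
theorem ruleDP_26 : ∀ P ∈ lP_26, RuleDMu4P cfg P := by decide +kernel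
/-- RULE D (μ₄, M) holds at the `P`-heads of chunk 27∕47. [kernel `decide`] -/
theorem ruleDP_27 : ∀ P ∈ lP_27, RuleDMu4P cfg P := by decide +kernel
/-- RULE D (μ₄, M) holds at the `P`-heads of chunk 28∕47. [kernel `decide`] -/
theorem ruleDP_28 : ∀ P ∈ lP_28, RuleDMu4P cfg P := by decide +kernel
/-- RULE D (μ₄, M) holds at the `P`-heads of chunk 29∕47. [kernel `decide`] -/
theorem ruleDP_29 : ∀ P ∈ lP_29, RuleDMu4P cfg P := by decide +kernel
/-- RULE D (μ₄, M) holds at the `P`-heads of chunk 30∕47. [kernel `decide`] -/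
theorem ruleDP_30 : ∀ P ∈ lP_30, RuleDMu4P cfg P := by decide +kernel
/-- RULE D (μ₄, M) holds at the `P`-heads of chunk 31∕47. [kernel `decide`] -/
theorem ruleDP_31 : ∀ P ∈ lP_31, RuleDMu4P cfg P := by decide +kernel
/-- RULE D (μ₄, M) holds at the `P`-heads of chunk 32∕47. [kernel `decide`] -/
theorem ruleDP_32 : ∀ P ∈ lP_32, RuleDMu4P cfg P := by decide +kernel
/-- RULE D (μ₄, M) holds at the `P`-heads of chunk 33∕47. [kernel `decide`] -/
theorem ruleDP_33 : ∀ P ∈ lP_33, RuleDMu4P cfg P := by decide +kernel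
/-- RULE D (μ₄, M) holds at the `P`-heads of chunk 34∕47. [kernel `decide`] -/
theorem ruleDP_34 : ∀ P ∈ lP_34, RuleDMu4P cfg P := by decide +kernel
/-- RULE D (μ₄, M) holds at the `P`-heads of chunk 35∕47. [kernel `decide`] -/
theorem ruleDP_35 : ∀ P ∈ lP_35, RuleDMu4P cfg P := by decide +kernel
/-- RULE D (μ₄, M) holds at the `P`-heads of chunk 36∕47. [kernel `decide`] -/
theorem ruleDP_36 : ∀ P ∈ lP_36, RuleDMu4P cfg P := by decide +kernel
/-- RULE D (μ₄, M) holds at the `P`-heads of chunk 37∕47. [kernel `decide`] -/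
theorem ruleDP_37 : ∀ P ∈ lP_37, RuleDMu4P cfg P := by decide +kernel
/-- RULE D (μ₄, M) holds at the `P`-heads of chunk 38∕47. [kernel `decide`] -/
theorem ruleDP_38 : ∀ P ∈ lP_38, RuleDMu4P cfg P := by decide +kernel
/-- RULE D (μ₄, M) holds at the `P`-heads of chunk 39∕47. [kernel `decide`] -/
theorem ruleDP_39 : ∀ P ∈ lP_39, RuleDMu4P cfg P := by decide +kernel
/-- RULE D (μ₄, M) holds at the `P`-heads of chunk 40∕47. [kernel `decide`] -/
theorem ruleDP_40 : ∀ P ∈ lP_40, RuleDMu4P cfg P := by decide +kernel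
/-- RULE D (μ₄, M) holds at the `P`-heads of chunk 41∕47. [kernel `decide`] -/
theorem ruleDP_41 : ∀ P ∈ lP_41, RuleDMu4P cfg P := by decide +kernel
/-- RULE D (μ₄, M) holds at the `P`-heads of chunk 42∕47. [kernel `decide`] -/
theorem ruleDP_42 : ∀ P ∈ lP_42, RuleDMu4P cfg P := by decide +kernel
/-- RULE D (μ₄, M) holds at the `P`-heads of chunk 43∕47. [kernel `decide`] -/
theorem ruleDP_43 : ∀ P ∈ lP_43, RuleDMu4P cfg P := by decide +kernel
/-- RULE D (μ₄, M) holds at the `P`-heads of chunk 44∕47. [kernel `decide`] -/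
theorem ruleDP_44 : ∀ P ∈ lP_44, RuleDMu4P cfg P := by decide +kernel
/-- RULE D (μ₄, M) holds at the `P`-heads of chunk 45∕47. [kernel `decide`] -/
theorem ruleDP_45 : ∀ P ∈ lP_45, RuleDMu4P cfg P := by decide +kernel
/-- RULE D (μ₄, M) holds at the `P`-heads of chunk 46∕47. [kernel `decide`] -/
theorem ruleDP_46 : ∀ P ∈ lP_46, RuleDMu4P cfg P := by decide +kernel
/-- RULE D (μ₄, M) holds at the `P`-heads of chunk 47∕47. [kernel `decide`] -/
theorem ruleDP_47 : ∀ P ∈ lP_47, RuleDMu4P cfg P := by decide +kernel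


end Summit.Ventures.HSemireg.Pad4Tower.LineDesignCert12
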